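import Summits.QuantumFields.YangMills.Theorems.FluctuationComparisonRegPrIntLOrganTangentFibreMeanTools
import Summits.QuantumFields.YangMills.Theorems.FluctuationComparisonRegPrIntLOrganTangentAPackageDescendTo
import Summits.QuantumFields.YangMills.Theorems.BalabanUVNodesN09DomAltThresholdNull
import Literature.MathematicalPhysics.QuantumFieldTheory.Balaban1983to89.T3OrbitAverage
import Literature.MathematicalPhysics.QuantumFieldTheory.Balaban1983to89.B12ContinuousTransportInvariance
import HarnessLib

/-!
# Crux `FluctuationComparisonRegPrIntL` (stmt-QuantumFields-20520, rung R3), PATH-B organ, v18 (H-currency): BRICK VU —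
# THE WINDOW-CONTINUOUS FIBRE-MEAN VERSION IS UNIQUE ON THE WINDOW (two disintegrations, two versions ⟹ equal everywhere on the open window; DEFINITION-FREE)

Cell `ym3-torus` (YM ladder rung R3 = continuum `SU(2)` Yang–Mills on the three-torus — a RUNG: NOT d = 4, NOT infinite volume, NOT a mass gap, NOT Clay).
LEAD-20520 width seat `ym-ust-20520-w3` (gen 25); step (i)∕(vii) of the V18 LIN KNIT SPEC (`Cruxes/…/V18-LIN-KNIT-SPEC-w3g25.md`, commit 187cdb3e021c);
`--kind proof --supports stmt-QuantumFields-20520 --as helper`, count-neutral, no registry ∕ binder ∕ `Lines/` edit, default heartbeats, `autoImplicit false`.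

WHY.  LINᵘ-H (✓p804070 BRICK 1's `hL`, text 80cc9579) quantifies over EVERY disintegration `σ` of product Haar along `descendTo F ℰp j Ts` and EVERY window-continuous `mfun`
with the (L20)-ratio identity `dU_j`-a.e. on the window; the knit evaluates `mfun` through ONE preferred object (the spread transport's fibred chart, SPREAD-TRANSPORT-H).  This
file is the bridge: any two such pairs `(σ, mfun)`, `(σ₀, mfun₀)` give `mfun = mfun₀` EVERYWHERE on the window.  Ingredients, all by name: disintegration uniqueness
✓`OrganTangentFibreMeanTools.ae_eq_of_bind_of_bind` (LEAD w3 g22) · transfer of `(dU_K.map D)`-null sets to `dU_j`-null sets on the window through the tower consistency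
`(mY).map D = ρ_j·dU_j` with `ρ_j > 0` there (✓`ae_on_of_ae_map_of_withDensity_eq`) · Haar on `SU(2)`-fields charges open sets (lit ✓`B12ContinuousTransportInvariance.
isOpenPosMeasure_fieldMeasure_SU`) · the window is open (✓`…N09DomAltThresholdNull.isOpen_setOf_plaqSmall_SU`) · Mathlib `Measure.eqOn_open_of_ae_eq`.

WHAT.  §1 ABSTRACT ★`version_unique_on_open`: standard Borel fibre space `Y`, base `X` with an open-positive measure `μX`, a map `d`, two Markov disintegrations `σ, σ₀` of
`m` along `d` (bind + fibre clauses), a consistency identity `(m.withDensity ρY).map d = μX.withDensity ρX` with `ρX ≠ 0` on an OPEN set `W`, two functions `f, f₀`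
continuous on `W` that are `μX`-a.e. on `W` the SAME functional `Λ` of the disintegration (`f V = Λ (σ V)`, `f₀ V = Λ (σ₀ V)`) ⟹ `EqOn f f₀ W`.  §2 ORGAN edition
★★`fibreMeanVersion_unique_window`: `X := G_j`, `Y := G_{Ts}`, `d := descendTo F ℰp j Ts`, `m := dU_{Ts}`, `μX := dU_j`, `W := {PlaqSmall (θBal F.L γ b₀ p₀ j)}`, `Λ κV :=
(∫ Ψ ∂κV) ∕ (∫ Ψ₀ ∂κV)` for ANY integrands `Ψ, Ψ₀ : G_{Ts} → ℝ` (the knit takes `Ψ := χ_{j,Ts}·(log ρ_{Ts} − log ρ′_{Ts})·ρ′_{Ts}`, `Ψ₀ := χ_{j,Ts}·ρ′_{Ts}` — (L20)'s ratio), the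
consistency supplied by ✓(L18) `towerCut_iterate` (as in ✓(L20)∕✓px5 E2E) with `ρX := ofReal ∘ ρ_j`.

HONEST FRAMING: measure-theoretic plumbing; nothing of Bałaban's analysis is asserted or proved; LINᵘ-H ∕ JVARᵘ-H ∕ O1ᵘ-H v2 ∕ S1aᴴ ∕ 26243 ∕ S2α′ ∕ S2β OPEN; crux 20520
`FluctuationComparisonRegPrIntL` ∕ `YM3TorusSU2` NOT proved; no summit ∕ sub-problem statement is proved; rung R3 = SU(2) YM₃ on T³ at fixed lattice data — NOT d = 4, NOT infinite
volume, NOT a mass gap, NOT Clay; the Yang–Mills mass gap is NOT proved.  [folklore]; [cite: Balaban1985Averaging, (10)-(13) p.19] for the averaging∕its disintegration.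
-/

set_option autoImplicit false

noncomputable section

namespace Summit.QuantumFields.YangMills.Theorems.OrganTangentFibreMeanVersionUnique

open MeasureTheory ProbabilityTheory Filter Topology Set Function
open scoped ENNReal
open Literature.MathematicalPhysics.QuantumFieldTheory.Balaban1983to89
open T3ContinuumYM3Torus T3NestedUnitLaws T3UnitLawDensityEML T3UnitScaleTilt T3LevelShift T3TiltDescent T4Continuum
open Literature.MathematicalPhysics.QuantumFieldTheory.Balaban1983to89.T3OrbitAverage
open Summit.QuantumFields.YangMills.Theorems.OrganTangentFibreMeanTools (ae_eq_of_bind_of_bind ae_on_of_ae_map_of_withDensity_eq)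
open Summit.QuantumFields.YangMills.BalabanUVNodes.N09DomAltThresholdNull (isOpen_setOf_plaqSmall_SU)

/-! ## §1 Abstract: two continuous versions of one disintegration functional agree on an open window -/

/-- ★ **VERSION UNIQUENESS ON AN OPEN SET** (see the module docstring). [folklore] -/
theorem version_unique_on_open {X Y : Type*} [MeasurableSpace X] [TopologicalSpace X] [OpensMeasurableSpace X]
    [MeasurableSpace Y] [StandardBorelSpace Y] [Nonempty Y]
    (m : Measure Y) [IsFiniteMeasure m] {d : Y → X} (hd : Measurable d)
    (σ σ₀ : Kernel X Y) [IsMarkovKernel σ] [IsMarkovKernel σ₀]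
    (hbind : (m.map d).bind ⇑σ = m) (hfib : ∀ᵐ V ∂(m.map d), ∀ᵐ U ∂(σ V), d U = V)
    (hbind₀ : (m.map d).bind ⇑σ₀ = m) (hfib₀ : ∀ᵐ V ∂(m.map d), ∀ᵐ U ∂(σ₀ V), d U = V)
    (μX : Measure X) [μX.IsOpenPosMeasure] (ρY : Y → ℝ≥0∞) {ρX : X → ℝ≥0∞} (hρX : AEMeasurable ρX μX)
    (hcons : (m.withDensity ρY).map d = μX.withDensity ρX)
    {W : Set X} (hWo : IsOpen W) (hW : ∀ V ∈ W, ρX V ≠ 0)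
    (Λ : Measure Y → ℝ) (f f₀ : X → ℝ) (hf : ContinuousOn f W) (hf₀ : ContinuousOn f₀ W)
    (hae : ∀ᵐ V ∂μX, V ∈ W → f V = Λ (σ V)) (hae₀ : ∀ᵐ V ∂μX, V ∈ W → f₀ V = Λ (σ₀ V)) :
    EqOn f f₀ W := by
  -- the two disintegrations agree `(m.map d)`-a.e., hence `μX`-a.e. on `W`
  have h1 : ∀ᵐ V ∂(m.map d), σ V = σ₀ V := ae_eq_of_bind_of_bind m hd σ σ₀ hbind hfib hbind₀ hfib₀
  have h2 : ∀ᵐ V ∂μX, V ∈ W → σ V = σ₀ V := ae_on_of_ae_map_of_withDensity_eq m hd μX ρY hρX hcons hW h1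
  have h3 : ∀ᵐ V ∂μX, V ∈ W → f V = f₀ V := by
    filter_upwards [h2, hae, hae₀] with V hσ hfV hf₀V hVW
    rw [hfV hVW, hf₀V hVW, hσ hVW]
  have h4 : f =ᵐ[μX.restrict W] f₀ := by
    rw [Filter.EventuallyEq, ae_restrict_iff' hWo.measurableSet]
    exact h3
  exact Measure.eqOn_open_of_ae_eq h4 hWo hf hf₀

/-! ## §2 Organ edition: the m-step localised fibre-mean version along `descendTo` is unique on the window -/

/-- ★★ **THE WINDOW-CONTINUOUS FIBRE-MEAN VERSION ALONG `descendTo F ℰp j Ts` IS UNIQUE ON THE WINDOW**: for ANY integrands `Ψ, Ψ₀` on the fine space, two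
disintegrations `σ, σ₀` of product Haar along `descendTo` (Markov, bind, fibre) and two `window_j`-continuous functions which are `dU_j`-a.e. on the window the ratio
`(∫ Ψ ∂σ_V) ∕ (∫ Ψ₀ ∂σ_V)` resp. `(∫ Ψ ∂σ₀_V) ∕ (∫ Ψ₀ ∂σ₀_V)`, given a tower consistency `mY.map descendTo = ρ_j·dU_j` (`mY ≪`-free: stated as `(dU_{Ts}.withDensity ρY).map …`)
with `ρ_j > 0` on the window — agree at EVERY window configuration. [cite: Balaban1985Averaging, (10)-(13) p.19] -/
theorem fibreMeanVersion_unique_window (F : T3Family) (γ b₀ p₀ : ℝ) (j Ts : ℕ) (hjTs : j ≤ Ts)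
    (σ σ₀ : Kernel (GaugeField (F.P j) 0 ↥(Matrix.specialUnitaryGroup (Fin 2) ℂ)) (GaugeField (F.P Ts) 0 ↥(Matrix.specialUnitaryGroup (Fin 2) ℂ)))
    [IsMarkovKernel σ] [IsMarkovKernel σ₀]
    (hbind : (Measure.map (descendTo F ℰp j Ts hjTs) (fieldMeasure (F.P Ts) 0 ↥(Matrix.specialUnitaryGroup (Fin 2) ℂ))).bind ⇑σ =
      fieldMeasure (F.P Ts) 0 ↥(Matrix.specialUnitaryGroup (Fin 2) ℂ))
    (hfib : ∀ᵐ V ∂(Measure.map (descendTo F ℰp j Ts hjTs) (fieldMeasure (F.P Ts) 0 ↥(Matrix.specialUnitaryGroup (Fin 2) ℂ))),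
      ∀ᵐ U ∂(σ V), descendTo F ℰp j Ts hjTs U = V)
    (hbind₀ : (Measure.map (descendTo F ℰp j Ts hjTs) (fieldMeasure (F.P Ts) 0 ↥(Matrix.specialUnitaryGroup (Fin 2) ℂ))).bind ⇑σ₀ =
      fieldMeasure (F.P Ts) 0 ↥(Matrix.specialUnitaryGroup (Fin 2) ℂ))
    (hfib₀ : ∀ᵐ V ∂(Measure.map (descendTo F ℰp j Ts hjTs) (fieldMeasure (F.P Ts) 0 ↥(Matrix.specialUnitaryGroup (Fin 2) ℂ))),
      ∀ᵐ U ∂(σ₀ V), descendTo F ℰp j Ts hjTs U = V)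
    (ρY : GaugeField (F.P Ts) 0 ↥(Matrix.specialUnitaryGroup (Fin 2) ℂ) → ℝ≥0∞)
    (ρj : GaugeField (F.P j) 0 ↥(Matrix.specialUnitaryGroup (Fin 2) ℂ) → ℝ) (hρjm : Measurable ρj)
    (hρjpos : ∀ V, PlaqSmall (θBal F.L γ b₀ p₀ j) V → 0 < ρj V)
    (hcons : ((fieldMeasure (F.P Ts) 0 ↥(Matrix.specialUnitaryGroup (Fin 2) ℂ)).withDensity ρY).map (descendTo F ℰp j Ts hjTs) =
      (fieldMeasure (F.P j) 0 ↥(Matrix.specialUnitaryGroup (Fin 2) ℂ)).withDensity (fun V => ENNReal.ofReal (ρj V)))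
    (Ψ Ψ₀ : GaugeField (F.P Ts) 0 ↥(Matrix.specialUnitaryGroup (Fin 2) ℂ) → ℝ)
    (mfun mfun₀ : GaugeField (F.P j) 0 ↥(Matrix.specialUnitaryGroup (Fin 2) ℂ) → ℝ)
    (hmc : ContinuousOn mfun {V | PlaqSmall (θBal F.L γ b₀ p₀ j) V}) (hmc₀ : ContinuousOn mfun₀ {V | PlaqSmall (θBal F.L γ b₀ p₀ j) V})
    (hae : ∀ᵐ V ∂(fieldMeasure (F.P j) 0 ↥(Matrix.specialUnitaryGroup (Fin 2) ℂ)), PlaqSmall (θBal F.L γ b₀ p₀ j) V →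
      mfun V = (∫ U, Ψ U ∂(σ V)) / (∫ U, Ψ₀ U ∂(σ V)))
    (hae₀ : ∀ᵐ V ∂(fieldMeasure (F.P j) 0 ↥(Matrix.specialUnitaryGroup (Fin 2) ℂ)), PlaqSmall (θBal F.L γ b₀ p₀ j) V →
      mfun₀ V = (∫ U, Ψ U ∂(σ₀ V)) / (∫ U, Ψ₀ U ∂(σ₀ V))) :
    ∀ V, PlaqSmall (θBal F.L γ b₀ p₀ j) V → mfun V = mfun₀ V := by
  haveI : (fieldMeasure (F.P j) 0 ↥(Matrix.specialUnitaryGroup (Fin 2) ℂ)).IsOpenPosMeasure :=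
    B12ContinuousTransportInvariance.isOpenPosMeasure_fieldMeasure_SU 2 (F.P j) 0
  haveI : Nonempty (GaugeField (F.P Ts) 0 ↥(Matrix.specialUnitaryGroup (Fin 2) ℂ)) := ⟨fun _ => 1⟩
  have hd : Measurable (descendTo F ℰp j Ts hjTs :
      GaugeField (F.P Ts) 0 ↥(Matrix.specialUnitaryGroup (Fin 2) ℂ) → GaugeField (F.P j) 0 ↥(Matrix.specialUnitaryGroup (Fin 2) ℂ)) :=
    measurable_descendTo F ℰp measurableE_ℰp hjTs
  have hWo : IsOpen {V : GaugeField (F.P j) 0 ↥(Matrix.specialUnitaryGroup (Fin 2) ℂ) | PlaqSmall (θBal F.L γ b₀ p₀ j) V} :=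
    isOpen_setOf_plaqSmall_SU 2 (F.P j) 0 _
  have hW : ∀ V ∈ {V : GaugeField (F.P j) 0 ↥(Matrix.specialUnitaryGroup (Fin 2) ℂ) | PlaqSmall (θBal F.L γ b₀ p₀ j) V},
      (fun V => ENNReal.ofReal (ρj V)) V ≠ 0 := fun V hV => by
    have := hρjpos V hV
    simpa [ENNReal.ofReal_eq_zero, not_le] using this
  have hρX : AEMeasurable (fun V => ENNReal.ofReal (ρj V)) (fieldMeasure (F.P j) 0 ↥(Matrix.specialUnitaryGroup (Fin 2) ℂ)) :=
    (ENNReal.measurable_ofReal.comp hρjm).aemeasurable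
  have h := version_unique_on_open (fieldMeasure (F.P Ts) 0 ↥(Matrix.specialUnitaryGroup (Fin 2) ℂ)) hd σ σ₀ hbind hfib hbind₀ hfib₀
    (fieldMeasure (F.P j) 0 ↥(Matrix.specialUnitaryGroup (Fin 2) ℂ)) ρY hρX hcons hWo hW
    (fun κV => (∫ U, Ψ U ∂κV) / (∫ U, Ψ₀ U ∂κV)) mfun mfun₀ hmc hmc₀ hae hae₀
  exact fun V hV => h hV

end Summit.QuantumFields.YangMills.Theorems.OrganTangentFibreMeanVersionUnique

end
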